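import Summits.BirchSwinnertonDyer.Rank1Residual.P2.CongruentNumberSilentEvenFiveDatumMonskyEven
import Literature.NumberTheory.EllipticCurves.Tian2014.CMPointSystemGenusBridge
import HarnessLib

/-!
# Cell `bsd-monsky`: THE ENCLOSURE OF C-P2-1 WITHOUT MONSKY 1990 COR 5.15, completed — route A's datum from
# Tian's CM-point system with rank one a KERNEL theorem, and C-P2-1 modulo `{hMe | hD} × {hSys | hSys′}`
# (the `{hMe, hSys′}` corner is the typer's `P2/CongruentNumberSilentEvenFiveEnclosureMonskyEven.lean`;
# this file adds the other three and the datum-level statements; nothing asserted)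

HONEST FRAMING (cell `bsd-monsky`, run/shared/lean/pub/bsd-monsky/, README §1: ONE theorem on ONE
explicit infinite family of quadratic twists of the congruent number curve at the prime `2`; not
"BSD for rank ≤ 1", nothing at odd primes, nothing booked until the cross-family referee passes the
written proof). This file asserts NO arithmetic fact. It is the typer's enclosure
`P2/CongruentNumberSilentEvenFiveEnclosure.lean` (`oddIndexHeegnerDatum_of_system (h515) (hSys)`,
`congruentSilentEvenFiveBSDTwo_of_system (h515) (hSys)`) re-derived WITHOUT the displayed fact `h515`
(Monsky 1990 Cor 5.15 + Remark (2)), at the level of the DATUM and for both `2`-Selmer inputs: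

* the system fact's M-y clause `D.MinusY` hands us a rational point `y′ ∉ 2E_{2pq}(ℚ) + tor`; with the
  kernel-counted `#Sel₂(E_{2pq}) = 8` from `hMe` (Heath-Brown 1994 appendix) or the bound `#Sel₂ ≤ 8`
  (`hD`, the written proof's Lemma 7.1 (a) / App. D) this makes rank `E_{2pq}(ℚ) = 1` a KERNEL theorem
  (`SelmerEight.lean` §2/§5), which is all the typer's proof used `h515` for (a generator `g` of the free
  part); the rest is the landed chain `minusY_of_monskyDisplays` → `exists_odd_scriptL_of_minusY_of_grossZagier`
  → `oddIndexHeegnerDatum_of_odd_scriptL`;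
* hence `oddIndexHeegnerDatum_of_system_of_monskyEven (hMe) (hSys)` / `…_of_selmer_le_eight (hD) (hSys)` (§1),
  and through `DatumMonskyEven.lean` the conjecture `Prop` `CongruentSilentEvenFiveBSDTwo` (C-P2-1 =
  Theorem 1.1 on `𝒮⁻`) modulo `{hMe, hSys}`, `{hD, hSys}` and `{hD, hSys′}` (§2) — the fourth corner
  `{hMe, hSys′}` is the typer's `congruentSilentEvenFiveBSDTwo_of_genusSystem_of_monskyEven` (same
  ingredients, rank one from `SelmerEight.lean` §2 as here).

So the `𝒮⁻` enclosure's displayed content is EXACTLY Tian's system with its printed properties (the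
cite-sheeted `hSys′`: `Printed`, `GrossZagierScriptL` (flagged assembly), `GenusTheoryDisplays`) plus ONE
`2`-Selmer input: either Monsky's appendix formula `hMe` (printed as a sketch for even `D`, CITED-FACTS C10 —
not a fully printed proof) or the written proof's own bound `hD` (PROOF-A Lemma 7.1 (a) = App. D, an
in-house input like `hA`, whose Selmer classes Lagrange printed in 1975). Nothing asserted; the conjecture
`Prop`s stay `@[conjecture]`; no mark moved.

References: [Tian2014] Def. 2.7, Thm. 2.8, (4.8), Prop. 2.1–2.2; [TianYuanZhang2017] Thm. 3.3, Thm. 1.1;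
[Monsky1990MockHeegner] Lemma 3.3 (3) + Remark (p. 53), Thm. 5.5, Thm. 5.9 (1) — Cor. 5.15 NOT used;
[HeathBrown1994SelmerCongruentII] §1, Appendix (Monsky) p. 41 L20–L36; [SilvermanAEC2009] Thm. X.4.2, Thm. VIII.6.7;
[Miller2011LMS] Def. 1.1; [Lagrange1975] J. Lagrange, Sém. Delange–Pisot–Poitou 16 (1974/75) exp. 16, §11 table p. 16-12
(the first-descent classes of `E_{2pq}`, printed 1975 — corroboration of `hD`, per the lit seat's sheet).
-/

noncomputable section

open scoped Classical

open WeierstrassCurve Literature.NumberTheory.EllipticCurves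
  Literature.NumberTheory.EllipticCurves.Rank1Residual
  Literature.NumberTheory.EllipticCurves.Rank1Residual.Typed
  Literature.NumberTheory.EllipticCurves.HeathBrown1994
  Literature.NumberTheory.EllipticCurves.Monsky1990
  Literature.NumberTheory.EllipticCurves.TianYuanZhang2017

set_option autoImplicit false

namespace Summit.BirchSwinnertonDyer.Rank1Residual.P2

open Conjectures Literature.NumberTheory.EllipticCurves.Tian2014

/-! ## §1 Route A ⟹ the datum, rank one from the Selmer count and the system's own point -/

/-- **Route A ⟹ the odd-index Heegner datum on `𝒮⁻`, with `hMe` in place of `h515`.** From the system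
`D` of `hSys`: `Printed ∧ MonskyDisplays ⟹ MinusY` (K1, `minusY_of_monskyDisplays`) gives `y′ ∈ E_{2pq}(ℚ)`
with `y′ ∉ 2E + tor`; `#Sel₂ = 8` (`hMe` + the kernel-counted matrix) and `y′` give rank `1`, hence a
generator `g`; `GrossZagierScriptL` + M-y give `𝓛(2pq)` odd; `oddIndexHeegnerDatum_of_odd_scriptL` closes.
The typer's `oddIndexHeegnerDatum_of_system` used `h515` exactly for the rank.
[cite: Monsky1990MockHeegner, Lemma 3.3 (3) and the Remark after it (p. 53), Thm. 5.5 (p. 62), Thm. 5.9 (1) (pp. 63–64)]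
[cite: TianYuanZhang2017, Thm. 3.3] [cite: HeathBrown1994SelmerCongruentII, Appendix (Monsky), typescript p. 41 L20–L36] -/
theorem oddIndexHeegnerDatum_of_system_of_monskyEven
    (hMe : monsky_card_selmerGroup_two_even) (hSys : tian2014_monsky1990_system_sMinus) :
    ∀ p q : ℕ, p.Prime → q.Prime → p % 8 = 5 → q % 4 = 3 → jacobiSym p q = -1 →
      OddIndexHeegnerDatum (2 * (p * q)) := by
  intro p q hp hq hp5 hq4 hj
  obtain ⟨hN, -, -, -⟩ := isCor515Family_two_mul_five_mul hp hq hp5 hq4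
  haveI := isElliptic_congruentNumberCurve hN.ne_zero
  obtain ⟨D, hP, hGZ, hM⟩ := hSys p q hp hq hp5 hq4 hj
  have hMY := D.minusY_of_monskyDisplays (Nat.mul_ne_zero hp.ne_zero hq.ne_zero) hN.squarefree hP hM
  obtain ⟨-, -, y', -, hnot⟩ := id hMY
  have hrank : (congruentNumberCurve (2 * (p * q))).mordellWeilRank = 1 :=
    mordellWeilRank_eq_one_of_card_selmerGroup_two_eq_eight hN.ne_zero
      (card_selmerGroup_two_two_mul_five_mul hMe hp hq hp5 hq4 hj) y' hnot
  obtain ⟨g, hg, -⟩ := exists_generatesFreePartRat_of_mordellWeilRank_eq_one hN.ne_zero hrank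
  obtain ⟨L, hLodd, hL⟩ := D.exists_odd_scriptL_of_minusY_of_grossZagier _ hGZ hMY g hg
  exact oddIndexHeegnerDatum_of_odd_scriptL hN.ne_zero hrank hLodd hL

/-- **Route A ⟹ the datum on `𝒮⁻`, with the written proof's Selmer bound `hD` in place of any named
fact**: as above, rank `1` now from `#Sel₂ ≤ 8` + the system's point (`SelmerEight.lean` §5). The bound
`hD` is PROOF-A Lemma 7.1 (a) (App. D, written out); its Selmer classes agree element for element with
Lagrange's 1975 first-descent table for `n = 2pq` (printed results, computations not displayed).
[cite: Monsky1990MockHeegner, Lemma 3.3 (3) and the Remark after it (p. 53), Thm. 5.5 (p. 62), Thm. 5.9 (1) (pp. 63–64)]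
[cite: TianYuanZhang2017, Thm. 3.3] [cite: SilvermanAEC2009, Thm. X.4.2, Thm. VIII.6.7]
[cite: Lagrange1975, §11 table p. 16-12 (NUMDAM SDPP_1974-1975__16_1_A11_0, PDF p. 13)] -/
theorem oddIndexHeegnerDatum_of_system_of_selmer_le_eight
    (hD : ∀ p q : ℕ, p.Prime → q.Prime → p % 8 = 5 → q % 4 = 3 → jacobiSym p q = -1 →
      Nat.card ((congruentNumberCurve (2 * (p * q))).selmerGroup 2) ≤ 8)
    (hSys : tian2014_monsky1990_system_sMinus) :
    ∀ p q : ℕ, p.Prime → q.Prime → p % 8 = 5 → q % 4 = 3 → jacobiSym p q = -1 →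
      OddIndexHeegnerDatum (2 * (p * q)) := by
  intro p q hp hq hp5 hq4 hj
  obtain ⟨hN, -, -, -⟩ := isCor515Family_two_mul_five_mul hp hq hp5 hq4
  haveI := isElliptic_congruentNumberCurve hN.ne_zero
  obtain ⟨D, hP, hGZ, hM⟩ := hSys p q hp hq hp5 hq4 hj
  have hMY := D.minusY_of_monskyDisplays (Nat.mul_ne_zero hp.ne_zero hq.ne_zero) hN.squarefree hP hM
  obtain ⟨-, -, y', -, hnot⟩ := id hMY
  have hrank : (congruentNumberCurve (2 * (p * q))).mordellWeilRank = 1 :=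
    (rank_eq_one_card_selmerGroup_two_eq_eight_sha_of_le_eight hN.ne_zero
      (hD p q hp hq hp5 hq4 hj) y' hnot).1
  obtain ⟨g, hg, -⟩ := exists_generatesFreePartRat_of_mordellWeilRank_eq_one hN.ne_zero hrank
  obtain ⟨L, hLodd, hL⟩ := D.exists_odd_scriptL_of_minusY_of_grossZagier _ hGZ hMY g hg
  exact oddIndexHeegnerDatum_of_odd_scriptL hN.ne_zero hrank hLodd hL

/-! ## §2 The enclosure: C-P2-1 modulo `{hMe, hSys}`, `{hD, hSys}`, `{hD, hSys′}` (the corner `{hMe, hSys′}` is the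
typer's `congruentSilentEvenFiveBSDTwo_of_genusSystem_of_monskyEven`; nothing asserted) -/

/-- **C-P2-1 modulo `hMe` and `hSys`** — `congruentSilentEvenFiveBSDTwo_of_system` with Heath-Brown 1994's
Selmer formula in place of Monsky 1990 Cor 5.15. Conditional; nothing asserted.
[cite: Tian2014, Thm. 2.8 (arXiv:1210.8231 p0011 L25–L44)] [cite: TianYuanZhang2017, Thm. 3.3]
[cite: HeathBrown1994SelmerCongruentII, Appendix (Monsky), typescript p. 41 L20–L36] [cite: Miller2011LMS, Def. 1.1 (arXiv:1010.2431 p. 3)] -/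
theorem congruentSilentEvenFiveBSDTwo_of_system_of_monskyEven
    (hMe : monsky_card_selmerGroup_two_even) (hSys : tian2014_monsky1990_system_sMinus) :
    CongruentSilentEvenFiveBSDTwo :=
  congruentSilentEvenFiveBSDTwo_of_oddIndexHeegnerDatum_of_monskyEven hMe
    (oddIndexHeegnerDatum_of_system_of_monskyEven hMe hSys)

/-- **C-P2-1 modulo the written proof's Selmer bound `hD` and `hSys`** — NO named fact beyond the system
(`hD` = PROOF-A App. D; Lagrange 1975 prints the same eight Selmer classes). Conditional; nothing asserted.
[cite: Tian2014, Thm. 2.8 (arXiv:1210.8231 p0011 L25–L44)] [cite: TianYuanZhang2017, Thm. 3.3]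
[cite: SilvermanAEC2009, Thm. X.4.2] [cite: Miller2011LMS, Def. 1.1 (arXiv:1010.2431 p. 3)]
[cite: Lagrange1975, §11 table p. 16-12 (NUMDAM SDPP_1974-1975__16_1_A11_0, PDF p. 13)] -/
theorem congruentSilentEvenFiveBSDTwo_of_system_of_selmer_le_eight
    (hD : ∀ p q : ℕ, p.Prime → q.Prime → p % 8 = 5 → q % 4 = 3 → jacobiSym p q = -1 →
      Nat.card ((congruentNumberCurve (2 * (p * q))).selmerGroup 2) ≤ 8)
    (hSys : tian2014_monsky1990_system_sMinus) :
    CongruentSilentEvenFiveBSDTwo :=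
  congruentSilentEvenFiveBSDTwo_of_oddIndexHeegnerDatum_of_selmer_le_eight hD
    (oddIndexHeegnerDatum_of_system_of_selmer_le_eight hD hSys)

/-- **C-P2-1 modulo `hD` and the genus form `hSys′`.** Conditional; nothing asserted.
[cite: Tian2014, Thm. 2.8 (arXiv:1210.8231 p0011 L25–L44)] [cite: TianYuanZhang2017, Thm. 3.3]
[cite: SilvermanAEC2009, Thm. X.4.2] [cite: Miller2011LMS, Def. 1.1 (arXiv:1010.2431 p. 3)]
[cite: Lagrange1975, §11 table p. 16-12 (NUMDAM SDPP_1974-1975__16_1_A11_0, PDF p. 13)] -/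
theorem congruentSilentEvenFiveBSDTwo_of_genusSystem_of_selmer_le_eight
    (hD : ∀ p q : ℕ, p.Prime → q.Prime → p % 8 = 5 → q % 4 = 3 → jacobiSym p q = -1 →
      Nat.card ((congruentNumberCurve (2 * (p * q))).selmerGroup 2) ≤ 8)
    (hSys' : tian2014_system_sMinus_genus) :
    CongruentSilentEvenFiveBSDTwo :=
  congruentSilentEvenFiveBSDTwo_of_system_of_selmer_le_eight hD
    (tian2014_monsky1990_system_sMinus_of_genus hSys')

end Summit.BirchSwinnertonDyer.Rank1Residual.P2

end
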